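import Literature.Probability.RandomPlanarGeometry.SAWBridgeRenewalLimit
import Literature.Probability.Process.StrongRenewalTheorem
import Mathlib.Analysis.SpecialFunctions.Pow.Real
import Mathlib.Analysis.SpecialFunctions.Pow.Asymptotics
import Mathlib.Analysis.SpecialFunctions.Trigonometric.Basic
import HarnessLib

/-!
# The strong renewal theorem applied to Kesten's bridge renewal: `b_n ∼ (sin πδ/(π C)) n^{δ−1} μ^n` under a regularly varying tail

Topic `Literature/Probability/RandomPlanarGeometry` (continues `SAWBridgeRenewalLimit.lean`; uses the named fact
`Process/StrongRenewalTheorem.lean`).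

Sources: N. Madras, G. Slade, *The Self-Avoiding Walk* (1993), §4.2 (p. 91; held text
`book:madras1993-self-avoiding-walk` p0077:L3–36): the renewal structure (4.2.4)–(4.2.5) of bridges and "the
Renewal Theorem implies that `lim b_N/μ^N` exists" — the tree's `MadrasSlade1993_p91_limit_exists` (limit only);
F. Caravenna, R. Doney, *Local large deviations and the strong renewal theorem*, EJP 24 (2019), Theorem 1.4 first
bullet (arXiv:1612.07635 p0004:L137–146): for `α > 1/2` the SRT holds with no extra assumption — the tree's NAMED
FACT `Renewal.CaravennaDoney2019_thm1_4_i` (discrete pure-power case). Neither source applies the SRT to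
self-avoiding walks.

## What is new in this file (not in print)

* `KestenTailRV d δ C` — the hypothesis that Kesten's tail `T_N = 1 − Σ_{k≤N} λ_k μ^{-k}` satisfies
  `T_N · N^δ → C > 0` (regular variation of index `−δ`, pure power; a hypothesis — no `δ` is established in print);
  `kestenTailRV_iff_tsum` rewrites it with the tail as the series `Σ_{k>N} λ_k μ^{-k}` (Kesten's relation);
* **`tendsto_bridge_rpow_of_kestenTailRV`** — the SRT named fact + `KestenTailRV d δ C` with `1/2 < δ < 1` give
  `b_n μ^{-n} n^{1−δ} → sin(πδ)/(πC)` (every `d ≥ 1`);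
* consequences under the same two hypotheses: `sharpBridge_lower/upper` (eventually
  `(L∓ε) n^{δ−1} μ^n ≶ b_n`), `bridgeAbundance_of_kestenTailRV` (pointwise bridge abundance with exponent `1−δ`),
  `tendsto_bridge_ratio_of_kestenTailRV` (`b_{n+1}/b_n → μ`).
Everything is conditional on exactly these two hypotheses (the SRT is published but unproved in the tree; the tail
hypothesis is not established). (Lane «pcv-sawmu» route R2.5; a-idea-1 typed, a-p5 proved.)
-/

noncomputable section

open Finset Filter Topology Literature.Probability.LatticeModels
open scoped BigOperators

namespace Literature.Probability.RandomPlanarGeometry.SAW.Zd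

variable (d : ℕ) [NeZero d]

/-- Kesten's tail `T_N = 1 - Σ_{k ≤ N} λ_k μ^{-k}` on `ℤ^d`.
[cite: MadrasSlade1993, §4.2, eq. (4.2.4) (p. 91)] -/
def kestenTailSum (N : ℕ) : ℝ :=
  1 - ∑ k ∈ range (N + 1), (irreducibleBridgeCount d k : ℝ) / connectiveConstant d ^ k

/-- **The regular-variation hypothesis `KestenTailRV d δ C`** (a predicate, used only as a HYPOTHESIS below):
Kesten's tail satisfies `T_N · N^δ → C` with `C > 0`, i.e. hypothesis (1.7) of Caravenna–Doney for the renewal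
law `p_k = λ_k μ^{-k}` with the pure-power scale `A(x) = x^δ/C`. No value of `δ` is established in print.
[cite: CaravennaDoney2019, eq. (1.7); MadrasSlade1993, §4.2 (p. 91)] -/
def KestenTailRV (δ C : ℝ) : Prop :=
  0 < C ∧ Tendsto (fun N : ℕ => kestenTailSum d N * (N : ℝ) ^ δ) atTop (𝓝 C)

variable {d}

/-- By Kesten's relation the tail is the shifted series: `T_N = Σ_{k ≥ 0} λ_{k+N+1} μ^{-(k+N+1)}`.
[cite: MadrasSlade1993, §4.2, eq. (4.2.4) (p. 91)] -/
theorem kestenTailSum_eq_tsum (N : ℕ) :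
    kestenTailSum d N = ∑' k : ℕ, (irreducibleBridgeCount d (k + (N + 1)) : ℝ) /
      connectiveConstant d ^ (k + (N + 1)) := by
  have hKR := MadrasSlade1993_eq424_holds d
  have h := hKR.summable.sum_add_tsum_nat_add (N + 1)
  rw [hKR.tsum_eq] at h
  rw [kestenTailSum]
  linarith

/-- `KestenTailRV` with the tail written as the shifted series `Σ_{k ≥ N+1} λ_k μ^{-k}`.
[cite: MadrasSlade1993, §4.2, eq. (4.2.4) (p. 91)] -/
theorem kestenTailRV_iff_tsum (δ C : ℝ) :
    KestenTailRV d δ C ↔ 0 < C ∧ Tendsto (fun N : ℕ =>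
      (∑' k : ℕ, (irreducibleBridgeCount d (k + (N + 1)) : ℝ) / connectiveConstant d ^ (k + (N + 1))) *
        (N : ℝ) ^ δ) atTop (𝓝 C) := by
  simp only [KestenTailRV, kestenTailSum_eq_tsum]

/-- **The strong renewal theorem applied to Kesten's bridge renewal.** Under the named fact `Renewal.CaravennaDoney2019_thm1_4_i` and the
crux `KestenTailRV d δ C` with `1/2 < δ < 1`: `bₙ μ^{-n} · n^{1-δ} → sin(πδ)/(π C)`.
[cite: CaravennaDoney2019, Theorem 1.4 (first bullet); MadrasSlade1993, §4.2 (p. 91)] -/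
theorem tendsto_bridge_rpow_of_kestenTailRV (hSRT : _root_.Literature.Probability.Process.Renewal.CaravennaDoney2019_thm1_4_i) {δ C : ℝ} (hδ : 1 / 2 < δ) (hδ1 : δ < 1)
    (h : KestenTailRV d δ C) :
    Tendsto (fun n : ℕ => (bridgeCount d n : ℝ) / connectiveConstant d ^ n * (n : ℝ) ^ (1 - δ))
      atTop (𝓝 (Real.sin (Real.pi * δ) / (Real.pi * C))) :=
  hSRT (fun n => (bridgeCount d n : ℝ) / connectiveConstant d ^ n)
    (fun k => (irreducibleBridgeCount d k : ℝ) / connectiveConstant d ^ k) δ C hδ hδ1 h.1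
    (bridgeCount_div_pow_zero d) (bridgeCount_div_pow_nonneg d) (bridgeCount_div_pow_le_one d)
    (irreducibleBridgeCount_div_pow_nonneg d) (irreducibleBridgeCount_div_pow_zero d)
    (fun _ hn => MadrasSlade1993_eq425 d hn) (MadrasSlade1993_eq424_holds d)
    (irreducibleBridgeCount_div_pow_one_pos d) h.2

/-- The SRT constant is positive: `sin(πδ)/(πC) > 0` for `0 < δ < 1`, `C > 0`. [folklore] -/
private theorem srt_const_pos {δ C : ℝ} (hδ0 : 0 < δ) (hδ1 : δ < 1) (hC : 0 < C) :
    0 < Real.sin (Real.pi * δ) / (Real.pi * C) := by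
  have h1 : 0 < Real.pi * δ := mul_pos Real.pi_pos hδ0
  have h2 : Real.pi * δ < Real.pi := by nlinarith [Real.pi_pos]
  exact div_pos (Real.sin_pos_of_pos_of_lt_pi h1 h2) (mul_pos Real.pi_pos hC)

/-- **Sharp bridge asymptotics, lower half**: for every `ε > 0`, eventually
`(sin(πδ)/(πC) - ε) · n^{δ-1} · μⁿ ≤ bₙ`.
[cite: CaravennaDoney2019, Theorem 1.4 (first bullet); MadrasSlade1993, §4.2 (p. 91)] -/
theorem sharpBridge_lower (hSRT : _root_.Literature.Probability.Process.Renewal.CaravennaDoney2019_thm1_4_i) {δ C : ℝ} (hδ : 1 / 2 < δ) (hδ1 : δ < 1)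
    (h : KestenTailRV d δ C) {ε : ℝ} (hε : 0 < ε) :
    ∀ᶠ n : ℕ in atTop, (Real.sin (Real.pi * δ) / (Real.pi * C) - ε) * (n : ℝ) ^ (δ - 1) *
      connectiveConstant d ^ n ≤ bridgeCount d n := by
  have ht := tendsto_bridge_rpow_of_kestenTailRV hSRT hδ hδ1 h
  have hev := (tendsto_order.1 ht).1 _ (sub_lt_self _ hε)
  filter_upwards [hev, eventually_gt_atTop 0] with n hn hn0
  have hμ : 0 < connectiveConstant d ^ n := pow_pos (connectiveConstant_pos d) n
  have hnpos : (0 : ℝ) < n := by exact_mod_cast hn0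
  have hr : (0 : ℝ) < (n : ℝ) ^ (1 - δ) := Real.rpow_pos_of_pos hnpos _
  -- `(L-ε) < u_n n^{1-δ}` ⇒ `(L-ε) n^{δ-1} μ^n ≤ b_n`
  have h1 : (Real.sin (Real.pi * δ) / (Real.pi * C) - ε) * (n : ℝ) ^ (δ - 1) ≤
      (bridgeCount d n : ℝ) / connectiveConstant d ^ n := by
    have h' : (Real.sin (Real.pi * δ) / (Real.pi * C) - ε) * (n : ℝ) ^ (δ - 1) ≤
        (bridgeCount d n : ℝ) / connectiveConstant d ^ n * (n : ℝ) ^ (1 - δ) * (n : ℝ) ^ (δ - 1) :=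
      mul_le_mul_of_nonneg_right hn.le (Real.rpow_nonneg hnpos.le _)
    rwa [mul_assoc, ← Real.rpow_add hnpos, show (1 - δ) + (δ - 1) = 0 by ring, Real.rpow_zero,
      mul_one] at h'
  rwa [le_div_iff₀ hμ] at h1

/-- **Sharp bridge asymptotics, upper half**: for every `ε > 0`, eventually
`bₙ ≤ (sin(πδ)/(πC) + ε) · n^{δ-1} · μⁿ`.
[cite: CaravennaDoney2019, Theorem 1.4 (first bullet); MadrasSlade1993, §4.2 (p. 91)] -/
theorem sharpBridge_upper (hSRT : _root_.Literature.Probability.Process.Renewal.CaravennaDoney2019_thm1_4_i) {δ C : ℝ} (hδ : 1 / 2 < δ) (hδ1 : δ < 1)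
    (h : KestenTailRV d δ C) {ε : ℝ} (hε : 0 < ε) :
    ∀ᶠ n : ℕ in atTop, (bridgeCount d n : ℝ) ≤
      (Real.sin (Real.pi * δ) / (Real.pi * C) + ε) * (n : ℝ) ^ (δ - 1) * connectiveConstant d ^ n := by
  have ht := tendsto_bridge_rpow_of_kestenTailRV hSRT hδ hδ1 h
  have hev := (tendsto_order.1 ht).2 _ (lt_add_of_pos_right _ hε)
  filter_upwards [hev, eventually_gt_atTop 0] with n hn hn0
  have hμ : 0 < connectiveConstant d ^ n := pow_pos (connectiveConstant_pos d) n
  have hnpos : (0 : ℝ) < n := by exact_mod_cast hn0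
  have h1 : (bridgeCount d n : ℝ) / connectiveConstant d ^ n ≤
      (Real.sin (Real.pi * δ) / (Real.pi * C) + ε) * (n : ℝ) ^ (δ - 1) := by
    have h' : (bridgeCount d n : ℝ) / connectiveConstant d ^ n * (n : ℝ) ^ (1 - δ) * (n : ℝ) ^ (δ - 1) ≤
        (Real.sin (Real.pi * δ) / (Real.pi * C) + ε) * (n : ℝ) ^ (δ - 1) :=
      mul_le_mul_of_nonneg_right hn.le (Real.rpow_nonneg hnpos.le _)
    rwa [mul_assoc, ← Real.rpow_add hnpos, show (1 - δ) + (δ - 1) = 0 by ring, Real.rpow_zero,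
      mul_one] at h'
  rwa [div_le_iff₀ hμ] at h1

/-- **Pointwise bridge abundance with exponent `1-δ` (`BA(1-δ)`)** under the crux and the SRT:
`∃ c > 0, ∀ᶠ n, c · n^{-(1-δ)} · μⁿ ≤ bₙ` (with `c = sin(πδ)/(2πC)`).
[cite: CaravennaDoney2019, Theorem 1.4 (first bullet); MadrasSlade1993, §4.2 (p. 91)] -/
theorem bridgeAbundance_of_kestenTailRV (hSRT : _root_.Literature.Probability.Process.Renewal.CaravennaDoney2019_thm1_4_i) {δ C : ℝ} (hδ : 1 / 2 < δ) (hδ1 : δ < 1)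
    (h : KestenTailRV d δ C) :
    ∃ c : ℝ, 0 < c ∧ ∀ᶠ n : ℕ in atTop,
      c * (n : ℝ) ^ (-(1 - δ)) * connectiveConstant d ^ n ≤ bridgeCount d n := by
  have hL := srt_const_pos (by linarith) hδ1 h.1
  refine ⟨Real.sin (Real.pi * δ) / (Real.pi * C) / 2, by positivity, ?_⟩
  filter_upwards [sharpBridge_lower hSRT hδ hδ1 h (half_pos hL)] with n hn
  rwa [show -(1 - δ) = δ - 1 by ring, show Real.sin (Real.pi * δ) / (Real.pi * C) / 2 =
    Real.sin (Real.pi * δ) / (Real.pi * C) - Real.sin (Real.pi * δ) / (Real.pi * C) / 2 by ring]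

/-- **The bridge ratio limit under the crux and the SRT**: `b_{n+1}/bₙ → μ`
(from `uₙ n^{1-δ} → L > 0`: `u_{n+1}/uₙ → 1`). Unconditionally only `lim b_N μ^{-N}` exists
(`MadrasSlade1993_p91_limit_exists`), which does not give the ratio when the limit is `0`.
[cite: CaravennaDoney2019, Theorem 1.4 (first bullet); MadrasSlade1993, Theorem 7.3.4 (d)] -/
theorem tendsto_bridge_ratio_of_kestenTailRV (hSRT : _root_.Literature.Probability.Process.Renewal.CaravennaDoney2019_thm1_4_i) {δ C : ℝ} (hδ : 1 / 2 < δ) (hδ1 : δ < 1)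
    (h : KestenTailRV d δ C) :
    Tendsto (fun n : ℕ => (bridgeCount d (n + 1) : ℝ) / bridgeCount d n) atTop
      (𝓝 (connectiveConstant d)) := by
  set L := Real.sin (Real.pi * δ) / (Real.pi * C) with hLdef
  have hL : 0 < L := srt_const_pos (by linarith) hδ1 h.1
  set μ := connectiveConstant d with hμdef
  have hμ : 0 < μ := connectiveConstant_pos d
  set v : ℕ → ℝ := fun n => (bridgeCount d n : ℝ) / μ ^ n * (n : ℝ) ^ (1 - δ) with hv
  have ht : Tendsto v atTop (𝓝 L) := tendsto_bridge_rpow_of_kestenTailRV hSRT hδ hδ1 h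
  have ht1 : Tendsto (fun n => v (n + 1)) atTop (𝓝 L) := ht.comp (tendsto_add_atTop_nat 1)
  -- `((n+1)/n)^{1-δ} → 1`, via `(n+1)/n → 1` and continuity of `x ↦ x^{1-δ}` at `1`
  have hq : Tendsto (fun n : ℕ => ((n : ℝ) / ((n : ℝ) + 1)) ^ (1 - δ)) atTop (𝓝 1) := by
    have h1 : Tendsto (fun n : ℕ => (n : ℝ) / ((n : ℝ) + 1)) atTop (𝓝 1) :=
      tendsto_natCast_div_add_atTop (1 : ℝ)
    have h2 : ContinuousAt (fun x : ℝ => x ^ (1 - δ)) 1 :=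
      Real.continuousAt_rpow_const 1 (1 - δ) (Or.inl one_ne_zero)
    have h3 := h2.tendsto.comp h1
    rw [Real.one_rpow] at h3
    exact h3
  -- the identity `b_{n+1}/b_n = μ · (v (n+1) / v n) · ((n/(n+1))^{1-δ})` for `n ≥ 1` with `b_n ≠ 0`
  have hmain : Tendsto (fun n : ℕ => μ * (v (n + 1) / v n) * ((n : ℝ) / ((n : ℝ) + 1)) ^ (1 - δ))
      atTop (𝓝 μ) := by
    have : Tendsto (fun n : ℕ => μ * (v (n + 1) / v n) * ((n : ℝ) / ((n : ℝ) + 1)) ^ (1 - δ))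
        atTop (𝓝 (μ * (L / L) * 1)) :=
      ((tendsto_const_nhds.mul (ht1.div ht hL.ne')).mul hq)
    simpa [div_self hL.ne'] using this
  refine hmain.congr' ?_
  have hvpos : ∀ᶠ n : ℕ in atTop, 0 < v n := (tendsto_order.1 ht).1 0 hL
  filter_upwards [hvpos, eventually_gt_atTop 0] with n hvn hn0
  have hnpos : (0 : ℝ) < n := by exact_mod_cast hn0
  have hn1pos : (0 : ℝ) < (n : ℝ) + 1 := by linarith
  have hbpos : (0 : ℝ) < bridgeCount d n := by
    -- `v n > 0` forces `b_n > 0`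
    by_contra hcon
    have hb0 : (bridgeCount d n : ℝ) = 0 := le_antisymm (not_lt.1 hcon) (Nat.cast_nonneg _)
    rw [hv] at hvn; simp [hb0] at hvn
  have hr : (0 : ℝ) < (n : ℝ) ^ (1 - δ) := Real.rpow_pos_of_pos hnpos _
  have hr1 : (0 : ℝ) < ((n : ℝ) + 1) ^ (1 - δ) := Real.rpow_pos_of_pos hn1pos _
  rw [hv]
  simp only [Nat.cast_add, Nat.cast_one]
  rw [Real.div_rpow hnpos.le hn1pos.le]
  field_simp
  ring


end Literature.Probability.RandomPlanarGeometry.SAW.Zd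

end
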